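import Literature.MathematicalPhysics.QuantumFieldTheory.OSDistributionSpaceHolomorphicSemigroupLaw
import Literature.MathematicalPhysics.QuantumFieldTheory.OSContinuationPieces
import HarnessLib

/-!
# The holomorphic semigroup `e^{-τH}` of a Schwinger family is an OS semigroup

Topic `Literature/MathematicalPhysics/QuantumFieldTheory`; support file (all proved; no new
definitions; no named facts) for the discharge of (A1) `OS1975_exists_timeContinuation`: the first
step of the instantiation of the abstract continuation engine (`OSLabelledPieces` … `OSTemperedBound`)
on an actual Schwinger family. Osterwalder–Schrader I (Comm. Math. Phys. 31 (1973)) §4.1, p. 92 and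
II (1975) Ch. V (5.3): the operators `e^{-τH}`, `Re τ ≥ 0`, on the OS Hilbert space form a weakly
holomorphic contraction semigroup, self-adjoint at real times — exactly the hypotheses
`OSEnvelope.IsOSSemigroup T 1` of the engine.

## References

* K. Osterwalder, R. Schrader, *Axioms for Euclidean Green's functions*, Comm. Math. Phys. 31 (1973)
  83–112, §4.1 p. 92. [OsterwalderSchraderCMP1973]
* K. Osterwalder, R. Schrader, *Axioms for Euclidean Green's functions II*, Comm. Math. Phys.
  42 (1975) 281–305, Ch. V (5.3). [OsterwalderSchraderCMP1975]
-/

noncomputable section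

open scoped InnerProductSpace ComplexConjugate

namespace Literature.MathematicalPhysics.QuantumFieldTheory

variable {d : ℕ} [NeZero d]

open Literature.MathematicalPhysics.QuantumLattice (SchwingerFamily)
open Literature.MathematicalPhysics.QuantumLattice.SchwingerFamily
open Literature.MathematicalPhysics.QuantumLattice.SchwingerFamily.OSSpace
open Literature.MathematicalPhysics.QuantumFieldTheory.OSEnvelope

variable {𝔖 : SchwingerFamily (EuclideanSpace ℝ (Fin d))} {hE2 : 𝔖.IsOSReflectionPositive}

/-- **`e^{-τH}` is an OS semigroup with bound `1`**: weakly holomorphic on `{Re τ > 0}`, of norm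
`≤ 1`, with the semigroup law on `{Re τ ≥ 0}`, self-adjoint at real times, `e^{-0H} = 1`. [cite: OsterwalderSchraderCMP1973, §4.1 p. 92] -/
theorem isOSSemigroup_holoShiftH (hE1 : 𝔖.IsEuclideanCovariant) :
    IsOSSemigroup (fun τ => holoShiftH (hE2 := hE2) hE1 τ) 1 where
  weakHolo u v := differentiableOn_inner_holoShiftH hE1 u v
  norm_le τ hτ := opNorm_holoShiftH_le_one hE1 hτ.le
  law a b ha hb := holoShiftH_add hE1 ha hb
  symm t ht u v := by
    have h := inner_holoShiftH_left (hE2 := hE2) hE1 (τ := (t : ℂ)) (by simpa using ht.le) u v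
    rwa [Complex.conj_ofReal] at h
  zero := holoShiftH_zero hE1

end Literature.MathematicalPhysics.QuantumFieldTheory
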